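import Mathlib
import HarnessLib
import Summits.Ventures.LatticeQCDFlow.Scaling.AcceptanceVolumeCeilingRigidityIntegral

/-!
# LatticeQCDFlow / Scaling — rigidity of the worst-block acceptance ceiling on a GENERAL space, II:
# `acc(p⊗p′, q⊗q′) = acc(p, q)` iff the glued block is perfect almost everywhere

HONEST FRAMING: exact (Metropolis-corrected) sampling algorithms for lattice gauge theory;
figures of merit are autocorrelation/cost numbers at stated couplings and volumes; no
continuum-physics claim.

Venture `LatticeQCDFlow` (cell pub-lqcd), topic `Scaling`; FANOUT row 3 (`s0-u1-a`, S0-B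
implementation A, GEN-14).  NEW WORK of the cell (elementary measure theory), the general-space form
of the worst-block half of row 3's finite `Scaling/AcceptanceVolumeCeilingRigidity`
(`accRate_prodLaw_eq_left_iff`), built on part I `Scaling/AcceptanceVolumeCeilingRigidityIntegral`
(imported: near-ratio pairs `measure_nearRatio_pos`, the inner equality case
`ae_le_mul_of_integral_innerKernel_eq`, the re-paired form `meanAccept_prod_eq_integral_rePair`) and
row 3's ceiling `meanAccept_prod_le_meanAccept_left` (`Scaling/AcceptanceVolumeSandwichIntegral`):
s-finite reference measures `μ` on `X`, `μ′` on `Y`, targets `p, p′ ≥ 0` with `∫ = 1`, models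
`q, q′ > 0` whose laws `q dμ`, `q′ dμ′` are probability measures,
`acc(p, q) = ∫∫ min(p(a)q(b), p(b)q(a)) dμ dμ`.  NO definition is introduced.

* **`ae_eq_of_meanAccept_prod_eq_meanAccept_left`** — `acc(p⊗p′, q⊗q′) = acc(p, q)` forces
  `p′ = q′` `μ′`-a.e.  THE APPROXIMATION ARGUMENT OFF THE DIAGONAL: the defect
  `min(w(a), w(b)) − ∫ min(w(a)w′(c), w(b)w′(d))` vanishes for `ν⊗ν`-a.e. outer pair; for every `n` a
  near-ratio outer pair of ratio below `1 + 1/(n+1)` with zero defect exists (part I §1), whence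
  `w′(c) ≤ (1 + 1/(n+1))·w′(d)` for a.e. `(c, d)` (part I §2); `n → ∞` and the swap give
  `w′(c) = w′(d)` a.e., so `w′` is a.e. the constant `∫ w′ dν′ = 1`, i.e. `p′ = q′` a.e. (`q′ > 0`);
* `meanAccept_prod_eq_meanAccept_left_of_ae_eq` — the converse (a perfect glued block costs nothing);
* **`meanAccept_prod_eq_meanAccept_left_iff`** — `acc(p⊗p′, q⊗q′) = acc(p, q) ↔ p′ =ᵐ[μ′] q′`;
* **`meanAccept_prod_lt_meanAccept_left`** — an imperfect glued block costs acceptance STRICTLY.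

Reading (value-free): on any pair of configuration spaces, gluing an independently proposed block to
an exact flow sampler leaves the equilibrium acceptance unchanged only if that block is sampled
perfectly; with row 3's floor rigidity (`Scaling/AcceptanceVolumeFloorRigidityIntegralEq`) both ends
of the general-space sandwich `acc·acc′ ≤ acc(⊗) ≤ acc` are now rigid.  NOT CLAIMED: a quantitative
defect; the `m`-block (`Measure.pi`) form; coupled (non-product) flows; any acceptance of ours;
nothing re-scored.
-/

namespace Summit.Ventures.LatticeQCDFlow.Theory2

open MeasureTheory Set Filter Topology
open Summit.Ventures.LatticeQCDFlow.Scoring.AllPairsVariance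

variable {X Y : Type*} [MeasurableSpace X] [MeasurableSpace Y] {μ : Measure X} {μ' : Measure Y}
  [SFinite μ] [SFinite μ'] {p q : X → ℝ} {p' q' : Y → ℝ}

/-- **`acc(p⊗p′, q⊗q′) = acc(p, q)` FORCES A PERFECT GLUED BLOCK**: for normalised targets
`p, p′ ≥ 0` and positive models `q, q′` with probability laws on arbitrary s-finite spaces, equality
in the worst-block ceiling implies `p′ = q′` `μ′`-almost everywhere.  The approximation argument off
the diagonal: the defect vanishes for a.e. outer pair; by §1 a near-ratio outer pair of ratio below
`1 + 1/(n+1)` carrying zero defect exists for every `n`, so by §2 `w′(c) ≤ (1 + 1/(n+1))·w′(d)` a.e.;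
`n → ∞` and the swap give `w′(c) = w′(d)` a.e., hence `w′` is a.e. the constant `∫ w′ = 1`. [ours] -/
theorem ae_eq_of_meanAccept_prod_eq_meanAccept_left (hp0 : ∀ x, 0 ≤ p x) (hpm : Measurable p)
    (hpi : Integrable p μ) (hp1 : ∫ x, p x ∂μ = 1) (hq0 : ∀ x, 0 < q x) (hqm : Measurable q)
    (hqi : Integrable q μ) (hp0' : ∀ y, 0 ≤ p' y) (hpm' : Measurable p') (hpi' : Integrable p' μ')
    (hp1' : ∫ y, p' y ∂μ' = 1) (hq0' : ∀ y, 0 < q' y) (hqm' : Measurable q') (hqi' : Integrable q' μ')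
    [IsProbabilityMeasure (μ.withDensity fun x => ENNReal.ofReal (q x))]
    [IsProbabilityMeasure (μ'.withDensity fun y => ENNReal.ofReal (q' y))]
    (heq : ∫ z, ∫ z', min (p z.1 * p' z.2 * (q z'.1 * q' z'.2)) (p z'.1 * p' z'.2 * (q z.1 * q' z.2))
        ∂(μ.prod μ') ∂(μ.prod μ') = ∫ a, ∫ b, min (p a * q b) (p b * q a) ∂μ ∂μ) :
    p' =ᵐ[μ'] q' := by
  set ν := μ.withDensity fun x => ENNReal.ofReal (q x) with hν
  set ν' := μ'.withDensity fun y => ENNReal.ofReal (q' y) with hν'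
  have hw : ∀ x, 0 ≤ p x / q x := fun x => div_nonneg (hp0 x) (hq0 x).le
  have hw' : ∀ y, 0 ≤ p' y / q' y := fun y => div_nonneg (hp0' y) (hq0' y).le
  have hwm' : Measurable fun y => p' y / q' y := hpm'.div hqm'
  obtain ⟨hwi', hw1'⟩ := integral_weight_withDensity_eq (μ := μ') hpi' hq0' hqm'
  rw [hp1'] at hw1'
  -- Step 1: the defect vanishes for `ν⊗ν`-a.e. outer pair
  have hKi := integrable_rePairKernel hp0 hpm hpi hq0 hqm hp0' hpm' hpi' hq0' hqm'
  have hIi : Integrable (fun ab : X × X => ∫ cd, min (p ab.1 / q ab.1 * (p' cd.1 / q' cd.1))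
      (p ab.2 / q ab.2 * (p' cd.2 / q' cd.2)) ∂(ν'.prod ν')) (ν.prod ν) := hKi.integral_prod_left
  have hFi : Integrable (fun ab : X × X => min (p ab.1 / q ab.1) (p ab.2 / q ab.2)) (ν.prod ν) :=
    (memLp_pairMin_two (μ := μ) hp0 hpm hpi hq0 hqm).integrable one_le_two
  have hg0 : 0 ≤ fun ab : X × X => min (p ab.1 / q ab.1) (p ab.2 / q ab.2)
      - ∫ cd, min (p ab.1 / q ab.1 * (p' cd.1 / q' cd.1)) (p ab.2 / q ab.2 * (p' cd.2 / q' cd.2))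
          ∂(ν'.prod ν') :=
    fun ab => sub_nonneg.2 (integral_innerKernel_le_min hw' hwi' hw1' (hw _) (hw _))
  have hint : ∫ ab, (min (p ab.1 / q ab.1) (p ab.2 / q ab.2)
      - ∫ cd, min (p ab.1 / q ab.1 * (p' cd.1 / q' cd.1)) (p ab.2 / q ab.2 * (p' cd.2 / q' cd.2))
          ∂(ν'.prod ν')) ∂(ν.prod ν) = 0 := by
    rw [integral_sub hFi hIi, integral_pairMin_withDensity_eq_meanAccept hp0 hpm hpi hq0 hqm hqi,
      ← meanAccept_prod_eq_integral_rePair hp0 hpm hpi hq0 hqm hqi hp0' hpm' hpi' hq0' hqm' hqi', heq,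
      sub_self]
  have hae : ∀ᵐ ab ∂(ν.prod ν),
      ∫ cd, min (p ab.1 / q ab.1 * (p' cd.1 / q' cd.1)) (p ab.2 / q ab.2 * (p' cd.2 / q' cd.2))
          ∂(ν'.prod ν') = min (p ab.1 / q ab.1) (p ab.2 / q ab.2) := by
    filter_upwards [(integral_eq_zero_iff_of_nonneg hg0 (hFi.sub hIi)).1 hint] with ab hab
    exact (sub_eq_zero.1 hab).symm
  -- Step 2: for every `n`, `w′(c) ≤ (1 + 1/(n+1))·w′(d)` almost everywhere
  have hpos := measure_weight_pos_ne_zero hp0 hpi hp1 hq0 hqm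
  have hstep : ∀ n : ℕ, ∀ᵐ cd ∂(ν'.prod ν'),
      p' cd.1 / q' cd.1 ≤ (1 + 1 / ((n : ℝ) + 1)) * (p' cd.2 / q' cd.2) := by
    intro n
    have hr : (1 : ℝ) < 1 + 1 / ((n : ℝ) + 1) := lt_add_of_pos_right _ (by positivity)
    have hN := measure_nearRatio_pos (ν := ν) (w := fun x => p x / q x) hpos hr
    obtain ⟨ab, ⟨ha, hb, hba, hab⟩, habeq⟩ :=
      Measure.exists_mem_of_measure_ne_zero_of_ae hN.ne' (ae_restrict_of_ae hae)
    exact ae_le_mul_of_integral_innerKernel_eq hw' hwm' hwi' hw1' ha hb hba.le hab.le habeq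
  -- Step 3: `n → ∞`, then symmetrise by the swap
  have hle : ∀ᵐ cd ∂(ν'.prod ν'), p' cd.1 / q' cd.1 ≤ p' cd.2 / q' cd.2 := by
    filter_upwards [ae_all_iff.2 hstep] with cd hcd
    have ht : Tendsto (fun n : ℕ => (1 + 1 / ((n : ℝ) + 1)) * (p' cd.2 / q' cd.2)) atTop
        (𝓝 ((1 + 0) * (p' cd.2 / q' cd.2))) :=
      (tendsto_const_nhds.add tendsto_one_div_add_atTop_nhds_zero_nat).mul tendsto_const_nhds
    rw [add_zero, one_mul] at ht
    exact ge_of_tendsto' ht fun n => hcd n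
  have hge : ∀ᵐ cd ∂(ν'.prod ν'), p' cd.2 / q' cd.2 ≤ p' cd.1 / q' cd.1 :=
    (Measure.measurePreserving_swap (μ := ν') (ν := ν')).quasiMeasurePreserving.ae hle
  have hcd : ∀ᵐ cd ∂(ν'.prod ν'), p' cd.1 / q' cd.1 = p' cd.2 / q' cd.2 := by
    filter_upwards [hle, hge] with cd h1 h2 using le_antisymm h1 h2
  -- Step 4: a weight a.e. equal to an independent copy of itself is a.e. the constant `∫ w′ = 1`
  haveI : (ae ν').NeBot := ae_neBot.2 (IsProbabilityMeasure.ne_zero ν')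
  obtain ⟨c₀, hc₀⟩ := (Measure.ae_ae_of_ae_prod hcd).exists
  have hK : ∫ y, p' y / q' y ∂ν' = p' c₀ / q' c₀ := by
    rw [integral_congr_ae (show (fun y => p' y / q' y) =ᵐ[ν'] fun _ => p' c₀ / q' c₀ from
      hc₀.mono fun d hd => hd.symm), integral_const, probReal_univ, one_smul]
  rw [hw1'] at hK
  have hν'1 : ∀ᵐ d ∂ν', p' d / q' d = 1 := hc₀.mono fun d hd => by rw [← hd, ← hK]
  -- Step 5: back to the reference measure (`q′ > 0`)
  have hμ' : ∀ᵐ d ∂μ', ENNReal.ofReal (q' d) ≠ 0 → p' d / q' d = 1 :=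
    (ae_withDensity_iff hqm'.ennreal_ofReal).1 hν'1
  filter_upwards [hμ'] with d hd
  have h1 := hd (ENNReal.ofReal_pos.2 (hq0' d)).ne'
  rwa [div_eq_one_iff_eq (hq0' d).ne'] at h1

/-- **A PERFECT GLUED BLOCK COSTS NOTHING**: if `p′ = q′` `μ′`-a.e. then
`acc(p⊗p′, q⊗q′) = acc(p, q)`. [ours] -/
theorem meanAccept_prod_eq_meanAccept_left_of_ae_eq (hp0 : ∀ x, 0 ≤ p x) (hpm : Measurable p)
    (hpi : Integrable p μ) (hq0 : ∀ x, 0 < q x) (hqm : Measurable q) (hqi : Integrable q μ)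
    (hp0' : ∀ y, 0 ≤ p' y) (hpm' : Measurable p') (hpi' : Integrable p' μ') (hq0' : ∀ y, 0 < q' y)
    (hqm' : Measurable q') (hqi' : Integrable q' μ')
    [IsProbabilityMeasure (μ.withDensity fun x => ENNReal.ofReal (q x))]
    [IsProbabilityMeasure (μ'.withDensity fun y => ENNReal.ofReal (q' y))] (h : p' =ᵐ[μ'] q') :
    ∫ z, ∫ z', min (p z.1 * p' z.2 * (q z'.1 * q' z'.2)) (p z'.1 * p' z'.2 * (q z.1 * q' z.2))
        ∂(μ.prod μ') ∂(μ.prod μ') = ∫ a, ∫ b, min (p a * q b) (p b * q a) ∂μ ∂μ := by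
  set ν := μ.withDensity fun x => ENNReal.ofReal (q x) with hν
  set ν' := μ'.withDensity fun y => ENNReal.ofReal (q' y) with hν'
  rw [meanAccept_prod_eq_integral_rePair hp0 hpm hpi hq0 hqm hqi hp0' hpm' hpi' hq0' hqm' hqi',
    ← integral_pairMin_withDensity_eq_meanAccept hp0 hpm hpi hq0 hqm hqi]
  have hμ'1 : ∀ᵐ y ∂μ', p' y / q' y = 1 := h.mono fun y hy => by
    rw [hy]
    exact div_self (hq0' y).ne'
  have hν'1 : ∀ᵐ y ∂ν', p' y / q' y = 1 := (withDensity_absolutelyContinuous μ' _).ae_le hμ'1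
  have h1 : ∀ᵐ cd ∂(ν'.prod ν'), p' cd.1 / q' cd.1 = 1 :=
    (Measure.quasiMeasurePreserving_fst (μ := ν') (ν := ν')).ae hν'1
  have h2 : ∀ᵐ cd ∂(ν'.prod ν'), p' cd.2 / q' cd.2 = 1 :=
    (Measure.quasiMeasurePreserving_snd (μ := ν') (ν := ν')).ae hν'1
  refine integral_congr_ae (Eventually.of_forall fun ab => ?_)
  calc ∫ cd, min (p ab.1 / q ab.1 * (p' cd.1 / q' cd.1)) (p ab.2 / q ab.2 * (p' cd.2 / q' cd.2))
        ∂(ν'.prod ν')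
      = ∫ _cd : Y × Y, min (p ab.1 / q ab.1) (p ab.2 / q ab.2) ∂(ν'.prod ν') := by
        refine integral_congr_ae ?_
        filter_upwards [h1, h2] with cd e1 e2
        rw [e1, e2, mul_one, mul_one]
    _ = min (p ab.1 / q ab.1) (p ab.2 / q ab.2) := by
        rw [integral_const, probReal_univ, one_smul]

/-- **RIGIDITY OF THE WORST-BLOCK CEILING ON A GENERAL SPACE**: for normalised targets `p, p′ ≥ 0`
and positive models `q, q′` with probability laws on arbitrary s-finite measure spaces,
`acc(p⊗p′, q⊗q′) = acc(p, q)` iff the glued block is perfect, `p′ = q′` `μ′`-a.e. [ours] -/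
theorem meanAccept_prod_eq_meanAccept_left_iff (hp0 : ∀ x, 0 ≤ p x) (hpm : Measurable p)
    (hpi : Integrable p μ) (hp1 : ∫ x, p x ∂μ = 1) (hq0 : ∀ x, 0 < q x) (hqm : Measurable q)
    (hqi : Integrable q μ) (hp0' : ∀ y, 0 ≤ p' y) (hpm' : Measurable p') (hpi' : Integrable p' μ')
    (hp1' : ∫ y, p' y ∂μ' = 1) (hq0' : ∀ y, 0 < q' y) (hqm' : Measurable q') (hqi' : Integrable q' μ')
    [IsProbabilityMeasure (μ.withDensity fun x => ENNReal.ofReal (q x))]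
    [IsProbabilityMeasure (μ'.withDensity fun y => ENNReal.ofReal (q' y))] :
    ∫ z, ∫ z', min (p z.1 * p' z.2 * (q z'.1 * q' z'.2)) (p z'.1 * p' z'.2 * (q z.1 * q' z.2))
        ∂(μ.prod μ') ∂(μ.prod μ') = ∫ a, ∫ b, min (p a * q b) (p b * q a) ∂μ ∂μ
      ↔ p' =ᵐ[μ'] q' :=
  ⟨ae_eq_of_meanAccept_prod_eq_meanAccept_left hp0 hpm hpi hp1 hq0 hqm hqi hp0' hpm' hpi' hp1' hq0'
      hqm' hqi',
    meanAccept_prod_eq_meanAccept_left_of_ae_eq hp0 hpm hpi hq0 hqm hqi hp0' hpm' hpi' hq0' hqm' hqi'⟩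

/-- **AN IMPERFECT GLUED BLOCK COSTS ACCEPTANCE STRICTLY**: if `p′ ≠ q′` on a set of positive
`μ′`-measure then `acc(p⊗p′, q⊗q′) < acc(p, q)`. [ours] -/
theorem meanAccept_prod_lt_meanAccept_left (hp0 : ∀ x, 0 ≤ p x) (hpm : Measurable p)
    (hpi : Integrable p μ) (hp1 : ∫ x, p x ∂μ = 1) (hq0 : ∀ x, 0 < q x) (hqm : Measurable q)
    (hqi : Integrable q μ) (hp0' : ∀ y, 0 ≤ p' y) (hpm' : Measurable p') (hpi' : Integrable p' μ')
    (hp1' : ∫ y, p' y ∂μ' = 1) (hq0' : ∀ y, 0 < q' y) (hqm' : Measurable q') (hqi' : Integrable q' μ')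
    [IsProbabilityMeasure (μ.withDensity fun x => ENNReal.ofReal (q x))]
    [IsProbabilityMeasure (μ'.withDensity fun y => ENNReal.ofReal (q' y))] (h : ¬ p' =ᵐ[μ'] q') :
    ∫ z, ∫ z', min (p z.1 * p' z.2 * (q z'.1 * q' z'.2)) (p z'.1 * p' z'.2 * (q z.1 * q' z.2))
        ∂(μ.prod μ') ∂(μ.prod μ') < ∫ a, ∫ b, min (p a * q b) (p b * q a) ∂μ ∂μ :=
  lt_of_le_of_ne (meanAccept_prod_le_meanAccept_left hp0 hpm hpi hq0 hqm hqi hp0' hpm' hpi' hp1' hq0'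
      hqm' hqi')
    fun heq => h (ae_eq_of_meanAccept_prod_eq_meanAccept_left hp0 hpm hpi hp1 hq0 hqm hqi hp0' hpm'
      hpi' hp1' hq0' hqm' hqi' heq)

end Summit.Ventures.LatticeQCDFlow.Theory2
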